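import Summits.QuantumFields.BalabanUV.Beta.AxialDressingRootedKernel

/-!
# The ROOTED axial dressing `Πᵀ_ρ` — part 5: the co-dressed kernel decays and is covariant; `Πᵀ_ρ` passes through series;
# the chain-rule vertex of rooted-dressed stencils is the rooted-dressed vertex

HONEST FRAMING (cell charter, verbatim): «discharging BetaPertH makes Balaban's UV stability UNCONDITIONAL — a real
constructive-QFT result; it is NOT the continuum limit and NOT the Clay problem.»  DERIVED cell leaf (pub-balaban β sub-cell,
lane an2 gen 12, item (ii-0) of NOTE X-an2-41 §4, file 2 of 3); no statement of Bałaban's papers is typed here, no `[cite:]` tag,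
no `Prop` fact; it instantiates no binder of the β-function wall by itself.  NOT `BetaPertH`; NOT continuum; NOT Clay.

## What is here (over part 4 `AxialDressingRootedKernel`: `piK`, `dressKAt = piK∘K∘piKᵀ`, `coDressKAt K = piKᵀ∘K∘piK`)

* §4 `spr_comp` (spread ∘ spread is spread); the co-dressed kernel DECAYS and is BLOCK-TRANSLATION COVARIANT
  (`decays_coDressKAt`, `spr_coDressKAt`, `shiftK_coDressKAt`) — the kernel-side hypotheses `hKd` / `hKs` of an5's
  `ChartConjugationEnd` ENDs for `K′ := coDressKAt ρ N K`.
* §5 `Πᵀ_ρ` passes through pointwise-summable series and finite sums (`coProjAt_tsum`, `legCo₁At_tsum`, `legCo₂At_tsum`,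
  `dressKAt_tsum`, `dressKAt_mul_left`, `dressKAt_finset_sum`, `dressKAt_wsum`), hence **`vertexOfK_dressKAt`**: the chain-rule
  vertex through `K` of rooted-dressed stencils is the rooted dressing of the vertex (twin of `AxialDressing.vertexOfK_dressK`).

Part 6 (`AxialDressingRootedHessian`) proves the windowed adjunction, the vertex transfer and the dressed-kernel identity
`TstepOf Lc j (dressAt hr J) = hessKer G (vertexOfK G Lc J.S) J.W`.
All declarations `[folklore]` (finite sums, absolutely convergent lattice sums); axioms standard.
Provenance: b2b-balaban β sub-cell, unit beta-an2 gen 12, 2026-08-19 (v1); over part 4, an5's `TameKernelCalculus`,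
`AxialDressing.summable_colH_mul_stencil` and `BalabanStepJetsSucc.decays_comp` BY NAME; no existing file touched.
-/

open Finset
open scoped BigOperators
open Literature.MathematicalPhysics.QuantumFieldTheory
open Literature.MathematicalPhysics.QuantumFieldTheory.Balaban1983to89
open Literature.MathematicalPhysics.QuantumFieldTheory.Balaban1983to89.Beta
open B12Sec2to5 (l1 l1_nonneg)
open ExpKernelCalculus (MKer Decays BiLoc comp tr bubble tadpole hessKer VertexFamily VertexFamily₂ shiftK l1_sub_symm)
open AffineAveraging (Form0 Form1 box toSite)
open AveragingContoursRooted (ctrOff ctrOff_mem_box)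
open OneStepResolventKernel (Fib wsum LocStencil JetData)
open OneStepKernelFamily (KInvStep decays_KInvStep shiftK_KInvStep colH vertexOfK vertexFamily_vertexOfK' TstepOf TbalOf)
open Summit.QuantumFields.BalabanUV.Beta.TameKernelCalculus

namespace Summit.QuantumFields.BalabanUV.Beta.AxialDressingRooted

noncomputable section

variable {d : ℕ}

/-! ## §4 Spread compositions; decay and covariance of the co-dressed kernel -/

section CoDressProps

/-- [folklore] Spread ∘ spread is spread (`BalabanStepJetsSucc.decays_comp` at the common rate, halved). -/
theorem spr_comp {A B : MKer (d + 1) (Fib d)} (hA : Spr A) (hB : Spr B) : Spr (comp A B) := by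
  obtain ⟨CA, δ₁, hδ₁, hA⟩ := hA
  obtain ⟨CB, δ₂, hδ₂, hB⟩ := hB
  have hδ : 0 < min δ₁ δ₂ := lt_min hδ₁ hδ₂
  have hA' := decays_of_le hA (min_le_left δ₁ δ₂)
  have hB' := decays_of_le hB (min_le_right δ₁ δ₂)
  exact ⟨_, min δ₁ δ₂ / 2, by linarith,
    BalabanStepJetsSucc.decays_comp hA' hB' (show 0 ≤ min δ₁ δ₂ / 2 by linarith) (show min δ₁ δ₂ / 2 < min δ₁ δ₂ by linarith)⟩

/-- [folklore] **THE CO-DRESSED KERNEL DECAYS** (in-block root): the `hKd` shape of `OneStepKernelFamily.vertexFamily_vertexOfK'` /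
`ChartConjugationEnd.axisReflectionCovariant_flipK_hessKer_conj`. -/
theorem decays_coDressKAt {N : ℕ} (hN : 1 ≤ N) {r : Fin (d + 1) → ℕ} (hr : r ∈ box (d + 1) N)
    {K : MKer (d + 1) (Fib d)} (hK : ∃ δ C : ℝ, 0 < δ ∧ 0 ≤ C ∧ Decays K C δ) :
    ∃ δ C : ℝ, 0 < δ ∧ 0 ≤ C ∧ Decays (coDressKAt (toSite r) N K) C δ := by
  obtain ⟨δ, C, hδ, -, hK⟩ := hK
  have hPt : Decays (trK (piK (toSite r) N)) (cP d N δ) δ := decays_trK (decays_piK hN hr hδ.le)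
  have h1 := BalabanStepJetsSucc.decays_comp hPt hK (show 0 ≤ δ / 2 by linarith) (show δ / 2 < δ by linarith)
  have hP : Decays (piK (toSite r) N) (cP d N (δ / 2)) (δ / 2) := decays_piK hN hr (by linarith)
  have h2 := BalabanStepJetsSucc.decays_comp h1 hP (show 0 ≤ δ / 4 by linarith) (show δ / 4 < δ / 2 by linarith)
  exact ⟨δ / 4, _, by linarith, h2.nonneg (Sum.inl 0), h2⟩

/-- [folklore] The co-dressed kernel of a spread kernel is spread. -/
theorem spr_coDressKAt {N : ℕ} (hN : 1 ≤ N) {r : Fin (d + 1) → ℕ} (hr : r ∈ box (d + 1) N)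
    {K : MKer (d + 1) (Fib d)} (hK : Spr K) : Spr (coDressKAt (toSite r) N K) :=
  spr_comp (spr_comp (spr_trK_piK hN hr) hK) (spr_piK hN hr)

/-- [folklore] Transposition commutes with shifts (by definition). -/
theorem trK_shiftK (v : Fin (d + 1) → ℤ) (K : MKer (d + 1) (Fib d)) : trK (shiftK v K) = shiftK v (trK K) := rfl

/-- [folklore] **BLOCK-TRANSLATION COVARIANCE OF THE CO-DRESSED KERNEL**: if `K` is invariant under the `N`-translations, so is
`coDressKAt ρ N K` (the `hKs` shape). -/
theorem shiftK_coDressKAt (ρ : Fin (d + 1) → ℤ) {N : ℕ} (hN : 1 ≤ N) {K : MKer (d + 1) (Fib d)}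
    (hKs : ∀ t : Fin (d + 1) → ℤ, shiftK (-((N : ℤ) • t)) K = K) (t : Fin (d + 1) → ℤ) :
    shiftK (-((N : ℤ) • t)) (coDressKAt ρ N K) = coDressKAt ρ N K := by
  rw [coDressKAt_eq, ← ExpKernelCalculus.comp_shiftK, ← ExpKernelCalculus.comp_shiftK, ← trK_shiftK, shiftK_piK ρ hN, hKs]

end CoDressProps

/-! ## §5 `Πᵀ_ρ` through series and finite sums; the chain-rule vertex of dressed stencils -/

section Linear

variable (ρ : Fin (d + 1) → ℤ) (N : ℕ) {ι : Type*}

/-- [folklore] `Πᵀ_ρ` passes through pointwise-summable series of one-forms. -/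
theorem coProjAt_tsum {g : ι → Form1 (d + 1) ℝ} (hg : ∀ κ p, Summable fun i => g i κ p) (α : Fin (d + 1))
    (q : Fin (d + 1) → ℤ) : coProjAt ρ N (fun κ p => ∑' i, g i κ p) α q = ∑' i, coProjAt ρ N (g i) α q := by
  simp only [coProjAt_apply]
  rw [Summable.tsum_finsetSum (fun v _ => summable_sum fun β _ => (hg β (q + v)).mul_left _)]
  refine Finset.sum_congr rfl fun v _ => ?_
  rw [Summable.tsum_finsetSum (fun β _ => (hg β (q + v)).mul_left _)]
  refine Finset.sum_congr rfl fun β _ => ?_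
  rw [tsum_mul_left]

/-- [folklore] … and the family `i ↦ Πᵀ_ρ g_i` is summable at every bond. -/
theorem summable_family_coProjAt {g : ι → Form1 (d + 1) ℝ} (hg : ∀ κ p, Summable fun i => g i κ p) (α : Fin (d + 1))
    (q : Fin (d + 1) → ℤ) : Summable fun i => coProjAt ρ N (g i) α q := by
  simp only [coProjAt_apply]
  exact summable_sum fun v _ => summable_sum fun β _ => (hg β (q + v)).mul_left _

/-- [folklore] `Πᵀ_ρ` on the first leg passes through pointwise-summable series of kernels. -/
theorem legCo₁At_tsum {F : ι → MKer (d + 1) (Fib d)} (hF : ∀ x z a b, Summable fun i => F i x z a b)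
    (x z : Fin (d + 1) → ℤ) (a b : Fib d) :
    legCo₁At ρ N (fun x z a b => ∑' i, F i x z a b) x z a b = ∑' i, legCo₁At ρ N (F i) x z a b := by
  rcases a with α | m
  · rw [legCo₁At_inl]
    exact coProjAt_tsum ρ N (g := fun i α' x' => F i x' z (Sum.inl α') b) (fun κ p => hF p z (Sum.inl κ) b) α x
  · rfl

/-- [folklore] … with a summable family of results. -/
theorem summable_family_legCo₁At {F : ι → MKer (d + 1) (Fib d)} (hF : ∀ x z a b, Summable fun i => F i x z a b)
    (x z : Fin (d + 1) → ℤ) (a b : Fib d) : Summable fun i => legCo₁At ρ N (F i) x z a b := by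
  rcases a with α | m
  · exact summable_family_coProjAt ρ N (g := fun i α' x' => F i x' z (Sum.inl α') b) (fun κ p => hF p z (Sum.inl κ) b) α x
  · exact hF x z (Sum.inr m) b

/-- [folklore] `Πᵀ_ρ` on the second leg passes through pointwise-summable series of kernels. -/
theorem legCo₂At_tsum {F : ι → MKer (d + 1) (Fib d)} (hF : ∀ x z a b, Summable fun i => F i x z a b)
    (x z : Fin (d + 1) → ℤ) (a b : Fib d) :
    legCo₂At ρ N (fun x z a b => ∑' i, F i x z a b) x z a b = ∑' i, legCo₂At ρ N (F i) x z a b := by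
  rcases b with β | m
  · rw [legCo₂At_inl]
    exact coProjAt_tsum ρ N (g := fun i β' z' => F i x z' a (Sum.inl β')) (fun κ p => hF x p a (Sum.inl κ)) β z
  · rfl

/-- [folklore] … with a summable family of results. -/
theorem summable_family_legCo₂At {F : ι → MKer (d + 1) (Fib d)} (hF : ∀ x z a b, Summable fun i => F i x z a b)
    (x z : Fin (d + 1) → ℤ) (a b : Fib d) : Summable fun i => legCo₂At ρ N (F i) x z a b := by
  rcases b with β | m
  · exact summable_family_coProjAt ρ N (g := fun i β' z' => F i x z' a (Sum.inl β')) (fun κ p => hF x p a (Sum.inl κ)) β z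
  · exact hF x z a (Sum.inr m)

/-- [folklore] **THE ROOTED DRESSING PASSES THROUGH POINTWISE-SUMMABLE SERIES OF KERNELS.** -/
theorem dressKAt_tsum {F : ι → MKer (d + 1) (Fib d)} (hF : ∀ x z a b, Summable fun i => F i x z a b)
    (x z : Fin (d + 1) → ℤ) (a b : Fib d) :
    dressKAt ρ N (fun x z a b => ∑' i, F i x z a b) x z a b = ∑' i, dressKAt ρ N (F i) x z a b := by
  rw [dressKAt_eq]
  have e : legCo₁At ρ N (fun x z a b => ∑' i, F i x z a b) = fun x z a b => ∑' i, legCo₁At ρ N (F i) x z a b :=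
    funext fun x => funext fun z => funext fun a => funext fun b => legCo₁At_tsum ρ N hF x z a b
  rw [e, legCo₂At_tsum ρ N (summable_family_legCo₁At ρ N hF) x z a b]
  rfl

/-- [folklore] The rooted dressing is homogeneous. -/
theorem dressKAt_mul_left (c : ℝ) (K : MKer (d + 1) (Fib d)) (x z : Fin (d + 1) → ℤ) (a b : Fib d) :
    dressKAt ρ N (fun x z a b => c * K x z a b) x z a b = c * dressKAt ρ N K x z a b := by
  have e1 : ∀ (K : MKer (d + 1) (Fib d)) x z a b, legCo₁At ρ N (fun x z a b => c * K x z a b) x z a b =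
      c * legCo₁At ρ N K x z a b := by
    intro K x z a b
    rcases a with α | m
    · simp only [legCo₁At_inl, coProjAt_apply, Finset.mul_sum]
      exact Finset.sum_congr rfl fun v _ => Finset.sum_congr rfl fun β _ => by ring
    · rfl
  have e2 : ∀ (K : MKer (d + 1) (Fib d)) x z a b, legCo₂At ρ N (fun x z a b => c * K x z a b) x z a b =
      c * legCo₂At ρ N K x z a b := by
    intro K x z a b
    rcases b with β | m
    · simp only [legCo₂At_inl, coProjAt_apply, Finset.mul_sum]
      exact Finset.sum_congr rfl fun v _ => Finset.sum_congr rfl fun β _ => by ring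
    · rfl
  rw [dressKAt_eq, dressKAt_eq]
  have e : legCo₁At ρ N (fun x z a b => c * K x z a b) = fun x z a b => c * legCo₁At ρ N K x z a b :=
    funext fun x => funext fun z => funext fun a => funext fun b => e1 K x z a b
  rw [e, e2]

/-- [folklore] The rooted dressing is additive over finite sums. -/
theorem dressKAt_finset_sum (s : Finset ι) (K : ι → MKer (d + 1) (Fib d)) (x z : Fin (d + 1) → ℤ) (a b : Fib d) :
    dressKAt ρ N (fun x z a b => ∑ i ∈ s, K i x z a b) x z a b = ∑ i ∈ s, dressKAt ρ N (K i) x z a b := by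
  have e1 : ∀ (K : ι → MKer (d + 1) (Fib d)) x z a b, legCo₁At ρ N (fun x z a b => ∑ i ∈ s, K i x z a b) x z a b =
      ∑ i ∈ s, legCo₁At ρ N (K i) x z a b := by
    intro K x z a b
    rcases a with α | m
    · simp only [legCo₁At_inl, coProjAt_apply, Finset.mul_sum]
      calc ∑ v ∈ cube (d + 1) N, ∑ β : Fin (d + 1), ∑ i ∈ s, (pm ρ N β (x + v) α x : ℝ) * K i (x + v) z (Sum.inl β) b
          = ∑ v ∈ cube (d + 1) N, ∑ i ∈ s, ∑ β : Fin (d + 1), (pm ρ N β (x + v) α x : ℝ) * K i (x + v) z (Sum.inl β) b :=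
            Finset.sum_congr rfl fun v _ => Finset.sum_comm
        _ = ∑ i ∈ s, ∑ v ∈ cube (d + 1) N, ∑ β : Fin (d + 1), (pm ρ N β (x + v) α x : ℝ) * K i (x + v) z (Sum.inl β) b :=
            Finset.sum_comm
    · rfl
  have e2 : ∀ (K : ι → MKer (d + 1) (Fib d)) x z a b, legCo₂At ρ N (fun x z a b => ∑ i ∈ s, K i x z a b) x z a b =
      ∑ i ∈ s, legCo₂At ρ N (K i) x z a b := by
    intro K x z a b
    rcases b with β | m
    · simp only [legCo₂At_inl, coProjAt_apply, Finset.mul_sum]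
      calc ∑ v ∈ cube (d + 1) N, ∑ β' : Fin (d + 1), ∑ i ∈ s, (pm ρ N β' (z + v) β z : ℝ) * K i x (z + v) a (Sum.inl β')
          = ∑ v ∈ cube (d + 1) N, ∑ i ∈ s, ∑ β' : Fin (d + 1), (pm ρ N β' (z + v) β z : ℝ) * K i x (z + v) a (Sum.inl β') :=
            Finset.sum_congr rfl fun v _ => Finset.sum_comm
        _ = ∑ i ∈ s, ∑ v ∈ cube (d + 1) N, ∑ β' : Fin (d + 1), (pm ρ N β' (z + v) β z : ℝ) * K i x (z + v) a (Sum.inl β') :=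
            Finset.sum_comm
    · rfl
  rw [dressKAt_eq]
  have e : legCo₁At ρ N (fun x z a b => ∑ i ∈ s, K i x z a b) = fun x z a b => ∑ i ∈ s, legCo₁At ρ N (K i) x z a b :=
    funext fun x => funext fun z => funext fun a => funext fun b => e1 K x z a b
  rw [e, e2]
  rfl

/-- [folklore] **THE ROOTED DRESSING PASSES THROUGH WEIGHTED SUPERPOSITIONS** (`OneStepResolventKernel.wsum`). -/
theorem dressKAt_wsum {w : (Fin (d + 1) → ℤ) → ℝ} {T : (Fin (d + 1) → ℤ) → MKer (d + 1) (Fib d)}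
    (hs : ∀ x z a b, Summable fun u => w u * T u x z a b) :
    dressKAt ρ N (wsum w T) = wsum w (fun u => dressKAt ρ N (T u)) := by
  funext x z a b
  calc dressKAt ρ N (wsum w T) x z a b
      = ∑' u, dressKAt ρ N (fun x z a b => w u * T u x z a b) x z a b :=
        dressKAt_tsum ρ N (F := fun u x z a b => w u * T u x z a b) hs x z a b
    _ = ∑' u, w u * dressKAt ρ N (T u) x z a b := tsum_congr fun u => dressKAt_mul_left ρ N (w u) (T u) x z a b
    _ = wsum w (fun u => dressKAt ρ N (T u)) x z a b := rfl

/-- [folklore] **THE CHAIN-RULE VERTEX THROUGH `K` OF ROOTED-DRESSED STENCILS IS THE ROOTED-DRESSED VERTEX:**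
`vertexOfK K N (fun κ u ↦ dressKAt ρ N (T κ u)) μ y = dressKAt ρ N (vertexOfK K N T μ y)` (decaying `K`, local `T`). -/
theorem vertexOfK_dressKAt {K : MKer (d + 1) (Fib d)} {C δ : ℝ} (hK : Decays K C δ) (hδ : 0 ≤ δ)
    {T : Fin (d + 1) → (Fin (d + 1) → ℤ) → MKer (d + 1) (Fib d)} {Ct δt : ℝ} (hT : LocStencil T Ct δt) (hδt : 0 < δt)
    (μ : Fin (d + 1)) (y : Fin (d + 1) → ℤ) :
    vertexOfK K N (fun κ u => dressKAt ρ N (T κ u)) μ y = dressKAt ρ N (vertexOfK K N T μ y) := by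
  have h : ∀ κ' : Fin (d + 1), wsum (colH K N μ y κ') (fun u => dressKAt ρ N (T κ' u)) =
      dressKAt ρ N (wsum (colH K N μ y κ') (T κ')) :=
    fun κ' => (dressKAt_wsum ρ N (fun x z a b => AxialDressing.summable_colH_mul_stencil hK hδ hT hδt κ' μ y x z a b)).symm
  funext x z a b
  calc vertexOfK K N (fun κ u => dressKAt ρ N (T κ u)) μ y x z a b
      = ∑ κ' : Fin (d + 1), wsum (colH K N μ y κ') (fun u => dressKAt ρ N (T κ' u)) x z a b := rfl
    _ = ∑ κ' : Fin (d + 1), dressKAt ρ N (wsum (colH K N μ y κ') (T κ')) x z a b :=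
        Finset.sum_congr rfl fun κ' _ => by rw [h κ']
    _ = dressKAt ρ N (fun x z a b => ∑ κ' : Fin (d + 1), wsum (colH K N μ y κ') (T κ') x z a b) x z a b :=
        (dressKAt_finset_sum ρ N Finset.univ (fun κ' => wsum (colH K N μ y κ') (T κ')) x z a b).symm
    _ = dressKAt ρ N (vertexOfK K N T μ y) x z a b := rfl

end Linear

end

end Summit.QuantumFields.BalabanUV.Beta.AxialDressingRooted
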